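import Mathlib.Geometry.Manifold.SmoothEmbedding
import Mathlib.Geometry.Manifold.Instances.Real
import Mathlib.MeasureTheory.Measure.Hausdorff
import Literature.Analysis.FluidPDE.DissipationAnomalyProofs
import HarnessLib

/-!
# Route `CylinderEntropy`, crux `CylinderRungTwo` (stmt-SmoothPoincare4-7631), line `killing-flux`:
# a weak limit of the area measures of slab-confined cross-sections exists (registered helper
# `helper_limitMeasureExists`, step S1 of the area-quantization plan)

Let `ι k : M → ℝ⁶` (`k ∈ ℕ`) be smooth embeddings of a closed `4`-manifold into the round cylinder
`N = S⁴ × ℝ = {z ∈ ℝ⁶ | ∑_{i<5} zᵢ² = 1}`, confined to the slab `|z₅| ≤ B`, with areas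
`μH⁴(range (ι k)) ≤ A + 1` converging to `A < ∞`.  Then along a subsequence `φ` the area measures
`μH⁴ ⌊ range (ι (φ k))` converge weakly (against bounded continuous test functions on `ℝ⁶`) to a
finite Borel measure `μ` on `ℝ⁶` of total mass `A` carried by the compact set
`K = {∑_{i<5} zᵢ² = 1, |z₅| ≤ B}`.

Proof (sequential Prokhorov, this file): the area measures are finite measures of mass `≤ A + 1`
carried by the compact `K` (closed and bounded in `ℝ⁶`: `‖z‖² = 1 + z₅² ≤ (1 + |B|)²`), so the
tree's `Literature.Analysis.FluidPDE.exists_subseq_tendsto_finiteMeasure_of_isCompact` (Prokhorov's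
theorem in sequential form for finite measures on a separable metrisable space) extracts a weakly
convergent subsequence with limit `ν`.  The mass of `ν` is the limit of the masses
(`Filter.Tendsto.mass`), i.e. `A`; and by the closed-set half of the portmanteau theorem
(`MeasureTheory.FiniteMeasure.limsup_measure_closed_le_of_tendsto`)
`ν K ≥ limsup μH⁴(K ∩ range (ι (φ k))) = limsup μH⁴(range (ι (φ k))) = A = ν univ`, whence
`ν Kᶜ = 0`.

References: P. Billingsley, *Convergence of probability measures*, 2nd ed. (1999), Thm. 5.1
(Prokhorov) and Thm. 2.1 (portmanteau); L. Simon, *Lectures on geometric measure theory* (1983),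
§4 (weak compactness of Radon measures).  Nothing about varifolds, rectifiability or the flow is
used or proved here.
-/

-- the prescribed namespace `Summit.SmoothPoincare4.SmoothPoincare4.…` repeats `SmoothPoincare4`
set_option linter.dupNamespace false

noncomputable section

open MeasureTheory Set Filter
open scoped Manifold ContDiff ENNReal NNReal Topology BigOperators

namespace Summit.SmoothPoincare4.SmoothPoincare4.Cruxes.CylinderRungTwo.KillingFlux

/-- **A weak limit of the area measures of slab-confined cross-sections exists** (registered helper
`helper_limitMeasureExists`, step S1 of the area-quantization plan of line `killing-flux`).  For
smooth embeddings `ι k : M → ℝ⁶` of a compact `4`-manifold into `N = {∑_{i<5} zᵢ² = 1}` with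
heights `|(ι k x)₅| ≤ B` and areas `μH⁴(range (ι k)) ≤ A + 1 → A < ∞`, there are a strictly
increasing `φ : ℕ → ℕ` and a finite Borel measure `μ` on `ℝ⁶` with `μ univ = A`,
`μ {z | ¬ (∑_{i<5} zᵢ² = 1 ∧ |z₅| ≤ B)} = 0`, and
`∫_{range (ι (φ k))} g dμH⁴ → ∫ g dμ` for every bounded continuous `g : ℝ⁶ → ℝ`
(sequential Prokhorov for finite measures carried by a fixed compact set, then continuity of the
mass and the closed-set portmanteau inequality; Billingsley 1999, Thms. 5.1 and 2.1). [folklore] -/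
theorem helper_limitMeasureExists : ∀ (M : Type) [TopologicalSpace M] [T2Space M] [SecondCountableTopology M] [ChartedSpace (EuclideanSpace ℝ (Fin 4)) M] [IsManifold (𝓡 4) ∞ M] [CompactSpace M] (ι : ℕ → M → EuclideanSpace ℝ (Fin 6)), (∀ k, Manifold.IsSmoothEmbedding (𝓡 4) (𝓡 6) ∞ (ι k)) → (∀ k x, ∑ i : Fin 5, ι k x (Fin.castSucc i) ^ 2 = 1) → ∀ B : ℝ, (∀ k x, |ι k x 5| ≤ B) → ∀ A : ℝ≥0∞, A < ⊤ → (∀ k, μH[4] (Set.range (ι k)) ≤ A + 1) → Filter.Tendsto (fun k => μH[4] (Set.range (ι k))) Filter.atTop (𝓝 A) → ∃ φ : ℕ → ℕ, StrictMono φ ∧ ∃ μ : Measure (EuclideanSpace ℝ (Fin 6)), IsFiniteMeasure μ ∧ μ Set.univ = A ∧ μ {z : EuclideanSpace ℝ (Fin 6) | ¬ (∑ i : Fin 5, z (Fin.castSucc i) ^ 2 = 1 ∧ |z 5| ≤ B)} = 0 ∧ ∀ g : BoundedContinuousFunction (EuclideanSpace ℝ (Fin 6)) ℝ, Filter.Tendsto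 (fun k => ∫ z in Set.range (ι (φ k)), g z ∂(μH[4] : Measure (EuclideanSpace ℝ (Fin 6)))) Filter.atTop (𝓝 (∫ z, g z ∂μ)) := by
  intro M _ _ _ _ _ _ ι _hemb hN B hB A hA hle harea
  -- Step 1: the area measures `μH⁴ ⌊ range (ι k)` are finite measures of mass `≤ A + 1`
  have hA1 : A + 1 < ⊤ := ENNReal.add_lt_top.2 ⟨hA, ENNReal.one_lt_top⟩
  have hfin : ∀ k, IsFiniteMeasure
      ((μH[4] : Measure (EuclideanSpace ℝ (Fin 6))).restrict (Set.range (ι k))) := fun k =>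
    ⟨by rw [Measure.restrict_apply_univ]; exact (hle k).trans_lt hA1⟩
  obtain ⟨m, hm⟩ : ∃ m : ℕ → FiniteMeasure (EuclideanSpace ℝ (Fin 6)), ∀ k,
      ((m k : FiniteMeasure (EuclideanSpace ℝ (Fin 6))) : Measure (EuclideanSpace ℝ (Fin 6))) =
        (μH[4] : Measure (EuclideanSpace ℝ (Fin 6))).restrict (Set.range (ι k)) :=
    ⟨fun k => ⟨_, hfin k⟩, fun _ => rfl⟩
  have hmass_eq : ∀ k, ((m k).mass : ℝ≥0∞) = μH[4] (Set.range (ι k)) := fun k => by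
    rw [FiniteMeasure.ennreal_mass, hm, Measure.restrict_apply_univ]
  have hmass : ∀ k, (m k).mass ≤ (A + 1).toNNReal := fun k => by
    rw [← ENNReal.coe_le_coe, hmass_eq, ENNReal.coe_toNNReal hA1.ne]
    exact hle k
  -- Step 2: the compact carrier `K = {∑_{i<5} zᵢ² = 1, |z₅| ≤ B}`
  set K : Set (EuclideanSpace ℝ (Fin 6)) :=
    {z | ∑ i : Fin 5, z (Fin.castSucc i) ^ 2 = 1 ∧ |z 5| ≤ B} with hK
  have hKc : IsClosed K := by
    rw [hK, Set.setOf_and]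
    exact (isClosed_eq (by fun_prop) continuous_const).inter
      (isClosed_le (by fun_prop) continuous_const)
  have hKb : Bornology.IsBounded K := by
    rw [isBounded_iff_forall_norm_le]
    refine ⟨1 + |B|, fun z hz => ?_⟩
    have hsq : ‖z‖ ^ 2 = ∑ i : Fin 5, z (Fin.castSucc i) ^ 2 + z 5 ^ 2 := by
      rw [EuclideanSpace.real_norm_sq_eq, Fin.sum_univ_castSucc]
      rfl
    have hz5 : |z 5| ≤ |B| := hz.2.trans (le_abs_self B)
    have h5 : z 5 ^ 2 ≤ |B| ^ 2 := by
      rw [← sq_abs (z 5)]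
      exact pow_le_pow_left₀ (abs_nonneg _) hz5 2
    refine le_of_pow_le_pow_left₀ two_ne_zero (by positivity) ?_
    rw [hsq, hz.1]
    nlinarith [abs_nonneg B]
  have hKcpt : IsCompact K := Metric.isCompact_of_isClosed_isBounded hKc hKb
  have hrange : ∀ k, Set.range (ι k) ⊆ K := fun k => by
    rintro _ ⟨x, rfl⟩
    exact ⟨hN k x, hB k x⟩
  have hmK : ∀ k, m k Kᶜ = 0 := fun k => by
    rw [FiniteMeasure.null_iff_toMeasure_null, hm, Measure.restrict_apply hKc.measurableSet.compl,
      (Set.disjoint_compl_left_iff_subset.2 (hrange k)).inter_eq, measure_empty]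
  -- Step 3: sequential Prokhorov
  obtain ⟨φ, hφ, ν, hν⟩ :=
    Literature.Analysis.FluidPDE.exists_subseq_tendsto_finiteMeasure_of_isCompact hKcpt m hmass hmK
  have hareaφ : Tendsto (fun k => μH[4] (Set.range (ι (φ k)))) atTop (𝓝 A) :=
    harea.comp hφ.tendsto_atTop
  -- Step 4: the mass of the limit is the limit `A` of the masses
  have hνuniv : (ν : Measure (EuclideanSpace ℝ (Fin 6))) Set.univ = A := by
    have h1 : Tendsto (fun k => (((m ∘ φ) k).mass : ℝ≥0∞)) atTop (𝓝 (ν.mass : ℝ≥0∞)) :=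
      ENNReal.tendsto_coe.2 hν.mass
    have h2 : (fun k => (((m ∘ φ) k).mass : ℝ≥0∞)) = fun k => μH[4] (Set.range (ι (φ k))) :=
      funext fun k => hmass_eq (φ k)
    rw [h2] at h1
    rw [← FiniteMeasure.ennreal_mass]
    exact tendsto_nhds_unique h1 hareaφ
  -- Step 5: the limit is carried by `K` (closed-set portmanteau inequality)
  have hνK : (ν : Measure (EuclideanSpace ℝ (Fin 6))) Kᶜ = 0 := by
    have hlimsup : atTop.limsup (fun k =>
        (((m ∘ φ) k : FiniteMeasure (EuclideanSpace ℝ (Fin 6))) :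
          Measure (EuclideanSpace ℝ (Fin 6))) K) ≤ (ν : Measure (EuclideanSpace ℝ (Fin 6))) K :=
      FiniteMeasure.limsup_measure_closed_le_of_tendsto hν hKc
    have hKfull : (fun k => (((m ∘ φ) k : FiniteMeasure (EuclideanSpace ℝ (Fin 6))) :
        Measure (EuclideanSpace ℝ (Fin 6))) K) = fun k => μH[4] (Set.range (ι (φ k))) := by
      funext k
      rw [Function.comp_apply, hm, Measure.restrict_apply hKc.measurableSet,
        Set.inter_eq_right.2 (hrange (φ k))]
    rw [hKfull, hareaφ.limsup_eq] at hlimsup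
    have hKA : (ν : Measure (EuclideanSpace ℝ (Fin 6))) K = A :=
      le_antisymm ((measure_mono (Set.subset_univ K)).trans hνuniv.le) hlimsup
    rw [measure_compl hKc.measurableSet (measure_ne_top _ _), hνuniv, hKA, tsub_self]
  -- Step 6: assemble (the weak convergence is the definition of convergence in `FiniteMeasure`)
  refine ⟨φ, hφ, ν, inferInstance, hνuniv, hνK, fun g => ?_⟩
  have hg := (FiniteMeasure.tendsto_iff_forall_integral_tendsto.1 hν) g
  simp only [Function.comp_apply, hm] at hg
  exact hg

end Summit.SmoothPoincare4.SmoothPoincare4.Cruxes.CylinderRungTwo.KillingFlux
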